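import Summits.Ventures.YMGap.Thresholds.StrongCouplingCubicTerm
import Summits.Ventures.YMGap.Thresholds.PlaquetteMonotone
import Summits.Ventures.YMGap.Thresholds.ZeroCouplingOnePlaquettePressure
import HarnessLib

/-!
# Instrument cell `ym-instrument`, crew (b), Q-B1/Q-B2 BASELINE: the strong-coupling series coefficients of `SU(2)`, `d = 4` that
# the KERNEL already certifies, as exact rationals in Wilson's normalisation, and the certified sign data — one index on the YangMills side

HONEST FRAMING (page 1, binding — cell `run/shared/lean/pub/ym-instrument/`, HUMAN RULING D-0084 (2), director-ym R138, questions Q-B1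
(series with certified remainder) and Q-B2 (certified monotonicity / sign data) of `QUESTIONS.md`).  WHAT IS CERTIFIED HERE AND AT WHICH
`(G, D, L, β)`: `G = SU(2)`, `D = 4`, Wilson action `β_W Σ_p (1 − ½ Re tr U_p)` with `β_W = 4/g²` (tree coupling `β_W/2`), INFINITE VOLUME
(`f` = thermodynamic limit of `L⁻⁴ log Z` along the tori `(ℤ/L)⁴`; `u` = mean plaquette `⟨½ Re tr U_p⟩` of the UNIQUE DLR state, which exists on
`0 ≤ β_W ≤ 9/25`), at the END POINT `β_W = 0` (Taylor coefficients through order 3 of `g`, order 2 of `u`) and on the one-state window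
`0 ≤ β_W ≤ 9/25` (signs).  EXACT RATIONALS, KERNEL-TIED: every number below is rewritten from a tree theorem of the venture package
`Summits/Ventures/YMGap/Thresholds/` (`PressureRegularity.*`, `ZeroCouplingSlope.*`), never transcribed — a wrong digit does not elaborate.
STRONG-COUPLING SIDE ONLY: nothing about `β_W > 9/25`, the weak window, a gap at weak coupling, the continuum; NOT summit-bearing.
WHAT IS NOT HERE (and not in the tree): any coefficient of order `≥ 4` of `g` or `≥ 3` of `u`; any coefficient or sign of the `0⁺⁺` mass `m(β)`
or the string tension `σ(β)` as functions of `β` (the tree has no such objects); any REMAINDER with a numerically useful constant (the tree's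
explicit remainder constants — C-LIP `TorusStateResponseBound`, the one-plaquette law `ZeroCouplingOnePlaquetteLaw` — are qualitative, see
this seat's `TYPING-MENU.md` §3).  An engine coefficient table (Münster / Drouffe–Zuber / Balian–Drouffe–Itzykson) is checkable against the
kernel exactly through the orders listed here and no further.

Contents. §1 free energy `g(β_W) := freeEnergyDensity 4 ρ_{SU(2)} (β_W/2)`: `g(0) = 0`, Taylor coefficients
`(g'(0)/1!, g''(0)/2!, g'''(0)/3!) = (−6, 3/4, 0)` (★ `su2_freeEnergyW_taylor3`), i.e. `g(β_W) = −6β_W + ¾β_W² + 0·β_W³ + o(β_W³)`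
(Balian–Drouffe–Itzykson).  §2 mean plaquette along any DLR selection on `[0, 9/25]`: `u(0) = 0`, `u'(0⁺) = 1/4`, `(u')'(0⁺) = 0`
(`su2_meanPlaquette_coeffs`), i.e. `u = β_W/4 + 0·β_W² + o(β_W²)`.  §3 Q-B2 baseline signs: `u` non-decreasing on `[0, 9/25]`, plaquette
susceptibility `Σ_q Cov(W_p, W_q) ≥ 0` on `(0, 9/25)` (by name from `PlaquetteMonotone`).
-/

noncomputable section

open MeasureTheory ProbabilityTheory Set
open Literature.MathematicalPhysics.QuantumLattice (LGConfig ZdPlaquette fundamentalRep ymGibbsMeasures freeEnergyDensity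
  continuous_fundamentalRep)
open Literature.MathematicalPhysics.QuantumFieldTheory (zdPlaquetteObs)
open Summit.Ventures.YMGap.PressureRegularity

namespace Summit.QuantumFields.YangMills.Theorems.Instrument.StrongCouplingSeriesCoefficients

/-! ## §1 The free energy in Wilson's normalisation: `g(0) = 0` and the Taylor coefficients through order 3 -/

/-- `SU(2)` is second countable (closed subgroup of the `2 × 2` complex matrices). [folklore] -/
private theorem secondCountable_su2 : SecondCountableTopology (Matrix.specialUnitaryGroup (Fin 2) ℂ) :=
  haveI : SecondCountableTopology (Matrix (Fin 2) (Fin 2) ℂ) :=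
    inferInstanceAs (SecondCountableTopology (Fin 2 → Fin 2 → ℂ))
  Topology.IsEmbedding.subtypeVal.secondCountableTopology

/-- **`g(0) = 0`**: the Wilson-normalised free energy density `g(β_W) = f(β_W/2)` of `SU(2)`, `d = 4` vanishes at `β_W = 0`
(every torus partition function is `1` at zero coupling; tree `ZeroCouplingSlope.freeEnergyDensity_zero_eq`). [folklore] -/
theorem su2_freeEnergyW_zero : freeEnergyDensity 4 (fundamentalRep (Fin 2)) ((0 : ℝ) / 2) = 0 := by
  haveI := secondCountable_su2
  rw [zero_div]
  exact Summit.Ventures.YMGap.ZeroCouplingSlope.freeEnergyDensity_zero_eq (d := 4) (fundamentalRep (Fin 2))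
    (continuous_fundamentalRep (Fin 2))

/-- `g'(0) = −6` as a value of `deriv` (tree: `su2_wilson_hasDerivAt_zero`, two-sided). [folklore] -/
theorem su2_freeEnergyW_deriv_zero :
    deriv (fun βW : ℝ => freeEnergyDensity 4 (fundamentalRep (Fin 2)) (βW / 2)) 0 = -6 :=
  su2_wilson_hasDerivAt_zero.deriv

/-- `g''(0) = 3/2` as a value of `deriv (deriv g)` (tree: `su2_wilson_hasDerivAt_deriv_zero`, two-sided). [folklore] -/
theorem su2_freeEnergyW_deriv_deriv_zero :
    deriv (deriv fun βW : ℝ => freeEnergyDensity 4 (fundamentalRep (Fin 2)) (βW / 2)) 0 = 3 / 2 :=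
  su2_wilson_hasDerivAt_deriv_zero.deriv

/-- `g'''(0) = 0` (tree: `su2_wilson_deriv_deriv_deriv_zero`, two-sided; the cubic Balian–Drouffe–Itzykson term vanishes). [folklore] -/
theorem su2_freeEnergyW_deriv_deriv_deriv_zero :
    deriv (deriv (deriv fun βW : ℝ => freeEnergyDensity 4 (fundamentalRep (Fin 2)) (βW / 2))) 0 = 0 :=
  su2_wilson_deriv_deriv_deriv_zero

/-- ★ **The strong-coupling Taylor coefficients of the `SU(2)`, `d = 4` free energy through order 3, as exact rationals (kernel).**
With `g(β_W) = lim L⁻⁴ log ∫ exp(−β_W Σ_p (1 − ½ Re tr U_p))` (`g ∈ C³` on `|β_W| < 9/25`: tree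
`PressureRegularity.su2_wilson_contDiffOn_three_abs`):
`(g(0), g'(0)/1!, g''(0)/2!, g'''(0)/3!) = (0, −6, 3/4, 0)`, i.e. `g(β_W) = −6 β_W + (3/4) β_W² + 0·β_W³ + o(β_W³)` — the table an
engine series must reproduce through order 3 (nothing of order `≥ 4` is a tree theorem). [folklore] -/
theorem su2_freeEnergyW_taylor3 :
    (freeEnergyDensity 4 (fundamentalRep (Fin 2)) ((0 : ℝ) / 2),
      iteratedDeriv 1 (fun βW : ℝ => freeEnergyDensity 4 (fundamentalRep (Fin 2)) (βW / 2)) 0 / (Nat.factorial 1 : ℝ),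
      iteratedDeriv 2 (fun βW : ℝ => freeEnergyDensity 4 (fundamentalRep (Fin 2)) (βW / 2)) 0 / (Nat.factorial 2 : ℝ),
      iteratedDeriv 3 (fun βW : ℝ => freeEnergyDensity 4 (fundamentalRep (Fin 2)) (βW / 2)) 0 / (Nat.factorial 3 : ℝ)) =
      ((0 : ℝ), (-6 : ℝ), (3 / 4 : ℝ), (0 : ℝ)) := by
  have h1 : iteratedDeriv 1 (fun βW : ℝ => freeEnergyDensity 4 (fundamentalRep (Fin 2)) (βW / 2)) 0 = -6 := by
    rw [iteratedDeriv_one]; exact su2_freeEnergyW_deriv_zero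
  have h2 : iteratedDeriv 2 (fun βW : ℝ => freeEnergyDensity 4 (fundamentalRep (Fin 2)) (βW / 2)) 0 = 3 / 2 := by
    rw [iteratedDeriv_succ, iteratedDeriv_one]; exact su2_freeEnergyW_deriv_deriv_zero
  have h3 : iteratedDeriv 3 (fun βW : ℝ => freeEnergyDensity 4 (fundamentalRep (Fin 2)) (βW / 2)) 0 = 0 := by
    rw [iteratedDeriv_succ, iteratedDeriv_succ, iteratedDeriv_one]
    exact su2_freeEnergyW_deriv_deriv_deriv_zero
  rw [su2_freeEnergyW_zero, h1, h2, h3]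
  norm_num [Nat.factorial]

/-! ## §2 The mean plaquette: `u(0) = 0`, `u'(0⁺) = 1/4`, `(u')'(0⁺) = 0` along any DLR selection -/

/-- ★ **The mean-plaquette coefficients through order 2, kernel.**  Along ANY DLR selection `β_W ↦ μ β_W ∈ 𝒢(β_W/2)` on `[0, 9/25]`
(the state is unique there) and for every plaquette `p`, with `u(β_W) = ⟨½ Re tr U_p⟩_{μ β_W}` and its derivative on the window, the
plaquette susceptibility `χ(β_W) = Σ_q Cov_{μ β_W}(W_p, W_q)`: `u(0) = 0`, `u` has right derivative `1/4` at `0` (within `[0, 9/25]`),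
and `χ` has right derivative `0` at `0` — i.e., since `u' = χ` on `(0, 9/25)` (tree `CouplingResponse.su2_hasDerivAt_plaquette_9_25`)
+ integration, `(b₀, b₁, b₂) = (0, 1/4, 0)`, `u = β_W/4 + 0·β_W² + o(β_W²)` (Balian–Drouffe–Itzykson; what an engine table must match is
exactly `χ'(0⁺) = 0`; tree `su2_plaquette_zero`, `su2_hasDerivWithinAt_plaquette_zero`, `su2_hasDerivWithinAt_susceptibility_zero`). [folklore] -/
theorem su2_meanPlaquette_coeffs
    {μ : ℝ → Measure (LGConfig 4 (Matrix.specialUnitaryGroup (Fin 2) ℂ))}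
    (hμ : ∀ βW ∈ Icc (0 : ℝ) (9 / 25), μ βW ∈ ymGibbsMeasures (d := 4) (fundamentalRep (Fin 2)) (2 * (βW / 4)))
    (p : ZdPlaquette 4) :
    (∫ U, zdPlaquetteObs (fundamentalRep (Fin 2)) p.1 p.2.1.1 p.2.1.2 U ∂(μ 0)) = 0 ∧
      HasDerivWithinAt (fun t => ∫ U, zdPlaquetteObs (fundamentalRep (Fin 2)) p.1 p.2.1.1 p.2.1.2 U ∂(μ t))
        (1 / 4 : ℝ) (Icc (0 : ℝ) (9 / 25)) 0 ∧
      HasDerivWithinAt (fun t => ∑' q : ZdPlaquette 4,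
          cov[zdPlaquetteObs (fundamentalRep (Fin 2)) p.1 p.2.1.1 p.2.1.2,
            zdPlaquetteObs (fundamentalRep (Fin 2)) q.1 q.2.1.1 q.2.1.2; μ t]) (0 : ℝ) (Ici (0 : ℝ)) 0 := by
  have h0 : μ 0 ∈ ymGibbsMeasures (d := 4) (fundamentalRep (Fin 2)) 0 := by
    simpa using hμ 0 ⟨le_rfl, by norm_num⟩
  exact ⟨su2_plaquette_zero h0 p, su2_hasDerivWithinAt_plaquette_zero hμ p, su2_hasDerivWithinAt_susceptibility_zero hμ p⟩

/-! ## §3 Q-B2 baseline: the certified SIGN data of the tree on the one-state window -/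

/-- ★ **Q-B2 baseline (signs, kernel, hypothesis-free).**  Along any DLR selection on `[0, 9/25]` and for every plaquette `p`:
the mean plaquette `u(β_W)` is NON-DECREASING on `[0, 9/25]` (convexity of the free energy, no correlation inequality), and at every
interior coupling `0 < β_W < 9/25` the plaquette susceptibility of the (unique) DLR state is `≥ 0`.  This is ALL the sign data the
tree certifies today: no statement about `dm/dβ` or `dσ/dβ` exists (tree `su2_meanPlaquette_monotoneOn`,
`su2_plaquette_responseSum_nonneg`). [folklore] -/
theorem su2_meanPlaquette_signs
    {μ : ℝ → Measure (LGConfig 4 (Matrix.specialUnitaryGroup (Fin 2) ℂ))}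
    (hμ : ∀ βW ∈ Icc (0 : ℝ) (9 / 25), μ βW ∈ ymGibbsMeasures (d := 4) (fundamentalRep (Fin 2)) (2 * (βW / 4)))
    (p : ZdPlaquette 4) :
    MonotoneOn (fun βW => ∫ U, zdPlaquetteObs (fundamentalRep (Fin 2)) p.1 p.2.1.1 p.2.1.2 U ∂(μ βW)) (Icc (0 : ℝ) (9 / 25)) ∧
      ∀ βW ∈ Ioo (0 : ℝ) (9 / 25), 0 ≤ ∑' q : ZdPlaquette 4,
        cov[zdPlaquetteObs (fundamentalRep (Fin 2)) p.1 p.2.1.1 p.2.1.2,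
          zdPlaquetteObs (fundamentalRep (Fin 2)) q.1 q.2.1.1 q.2.1.2; μ βW] := by
  refine ⟨su2_meanPlaquette_monotoneOn hμ p, fun βW hβ => ?_⟩
  have hβ' : βW / 2 ∈ Ioo (0 : ℝ) (9 / 50) := ⟨by linarith [hβ.1], by linarith [hβ.2]⟩
  have hν : μ βW ∈ ymGibbsMeasures (d := 4) (fundamentalRep (Fin 2)) (βW / 2) := by
    have h := hμ βW ⟨hβ.1.le, hβ.2.le⟩
    rwa [show (2 : ℝ) * (βW / 4) = βW / 2 by ring] at h
  exact su2_plaquette_responseSum_nonneg hβ' hν p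

end Summit.QuantumFields.YangMills.Theorems.Instrument.StrongCouplingSeriesCoefficients

end
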